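import Summits.AnomalousDissipation.AnomalousDissipation.Theorems.BaireTransferRobustLoudUpgradeStubUnfoldingPersistA
import Literature.Analysis.Calculus.BorderedUnfoldingPersistence

/-!
# Stub `stub_unfoldingPersist` of the line `malkin-cone-group-orbits` (crux stmt-AnomalousDissipation-1144, companion c5
# "the intrinsic unfolding"): persistence of a simply degenerate steady state along the viscosity/Galilean-drift unfolding

Registered stub `stub_unfoldingPersist` (Pi-form), proved here.  Let `u₀` be a classical steady state of `NS_ν(f_c)`
(`ν > 0`, ANY spatial mean `m = ⨍u₀`) whose classical mean-zero kernel of the linearisation `L(ν,u₀)` lies on the complex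
line of a smooth divergence-free mean-zero real field `v`, and let the INTRINSIC border field
`h = αΔu₀ + ∑ᵢ dirᵢ ∂ᵢu₀` (`α ∈ ℝ`, `dir ∈ ℤ³`) be first-order visible, `h ∉ range L(ν,u₀)`.  Writing `u = m + w`, the
steady states of mean `m + r·dir` at viscosity `ν − rα` are the zeros of the DRIFTED steady lattice map
`N(x, r) = 4π²(ν − rα) x + D_m x + r D_dir x + B(x,x) − F c'` on the state space `W` of
`Literature/Analysis/FluidPDE/SteadyNSLatticePersistence(Drift).lean` (`D_M` the compact drift multiplier
`x̌(k) ↦ 2πi (k·M) x̌(k)`), and `∂N/∂r (x₀, 0) = D_dir x₀ − 4π²α x₀` is the coefficient vector of `h`.  Hence the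
abstract persistence lemma `Literature.Analysis.Calculus.bordered_unfolding_persistence` (bordered implicit function
theorem with a state-dependent border: compact perturbation of `4π²ν·1`, kernel inside `ℝ·g`, border outside the
range) solves `N(x, r) = F c'` for every `c'` near `c` with `(x, r) → (x₀, 0)`; lattice regularity
(`SteadyLatticeDrift.rapidDecay_of_perturbed_eq`) and synthesis (`SteadyLatticeDrift.steadyState_of_fourier'`) turn
`(x, r)` into a classical steady state `u'` of `NS_{ν − rα}(f_{c'})` of mean `m + r·dir`, and Parseval
(part A, `…StubUnfoldingPersistA.lean`: `exists_steadyState_of_drifted_eq`, `h1DistSq_le_of_states`) bounds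
`∫‖u' − u₀‖² + ‖∇(u' − u₀)‖₂²` by `(1 + 4π²)‖x − x₀‖² + r²|dir|²`.  Pure proof file.  References: Temam 1979 Ch. II §1; Chow–Hale 1982 §2.4; Kielhöfer 2012 §I.2; the route file (item 1144).
-/

-- `Summit.<Summit>.<Problem>` is the tree's mandated summit-side namespace (CONVENTIONS §2); for this
-- single-conjunct summit the two coincide, so the duplicate is deliberate.
set_option linter.dupNamespace false

noncomputable section

open scoped BigOperators Topology ENNReal NNReal InnerProductSpace ComplexConjugate
open Filter Set Function TopologicalSpace MeasureTheory UnitAddTorus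

namespace Summit.AnomalousDissipation.AnomalousDissipation.Theorems.RobustLoudUpgrade.Unfolding

open Literature.Analysis.FunctionSpaces Literature.Analysis.FunctionSpaces.Torus
open Literature.Analysis.FunctionSpaces.EuclideanSpace
open Literature.Analysis.FluidPDE
open Literature.Analysis.FluidPDE.ScalarFourier
open Literature.Analysis.FluidPDE.SteadyLattice
open Literature.Analysis.FluidPDE.SteadyLatticeDrift
open Literature.Analysis.Calculus
open Summit.AnomalousDissipation.AnomalousDissipation.Theses.BaireTransfer
open Summit.AnomalousDissipation.AnomalousDissipation.Theorems.RobustLoudUpgrade.SteadyPersist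
open Summit.AnomalousDissipation.AnomalousDissipation.Theorems.RobustLoudUpgrade.LsFamily

/-! ## The registered stub -/

section Main

variable {S : Finset (Fin 3 → ℤ)}

set_option maxHeartbeats 3200000 in
/-- **Registered stub `stub_unfoldingPersist`** (companion c5 of the line `malkin-cone-group-orbits`): persistence of a simply
degenerate classical steady state of any mean along the intrinsic unfolding `(ν, m) ↦ (ν − rα, m + r·dir)` whose generator
`αΔu₀ + dir·∇u₀` is first-order visible; see the module docstring. [folklore] -/
theorem stub_unfoldingPersist : ∀ (S : Finset (Fin 3 → ℤ)) (c : Coeff S) (ν : ℝ) (u₀ : UnitAddTorus (Fin 3) → EuclideanSpace ℝ (Fin 3)) (p₀ : UnitAddTorus (Fin 3) → ℝ) (v : UnitAddTorus (Fin 3) → EuclideanSpace ℝ (Fin 3)) (α : ℝ) (dir : Fin 3 → ℤ), 0 < ν → Torus.IsSteadyNSState ν (force S c) u₀ p₀ → IsSmooth v → IsDivFree v → HasZeroMean v → (∀ w, Torus.LinNSResolventRel ν u₀ 0 w 0 → ∃ z : ℂ, w = z • cplx v) → (∀ w, ¬ Torus.LinNSResolventRel ν u₀ 0 w (cplx (fun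 x => α • laplacian u₀ x + ∑ i, (dir i : ℝ) • partialDeriv i u₀ x))) → ∀ δ : ℝ, 0 < δ → ∃ r : ℝ, 0 < r ∧ ∀ c' : Coeff S, dist c' c < r → ∃ (ν' : ℝ) (u' : UnitAddTorus (Fin 3) → EuclideanSpace ℝ (Fin 3)) (p' : UnitAddTorus (Fin 3) → ℝ), |ν' - ν| < δ ∧ Torus.IsSteadyNSState ν' (force S c') u' p' ∧ h1DistSq u' u₀ < δ := by
  intro S c ν u₀ p₀ v α dir hν hst hv₁ hv₂ hv₃ hker hvis δ hδ
  -- §1 the unperturbed state on the Fourier side (full family; the zero mode is the mean)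
  have hu₀ : IsSmooth u₀ := hst.smooth_velocity.isSmooth_slice (Set.mem_univ 0)
  have hdiv₀ : IsDivFree u₀ := hst.divFree 0 (Set.mem_univ 0)
  set a : (Fin 3 → ℤ) → (EuclideanSpace ℂ (Fin 3)) := mFourierCoeff (complexify ∘ u₀) with ha
  have har : RapidDecay a := hu₀.complexify_comp.rapidDecay_mFourierCoeff
  have hat : ∀ m : (Fin 3 → ℤ), (∑ jj : Fin 3, ((m jj : ℤ) : ℂ) * (a m) jj) = 0 :=
      fun m => hdiv₀.sum_mul_mFourierCoeff_eq_zero hu₀ m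
  have hacs : IsConjSymm a := isConjSymm_mFourierCoeff hu₀.integrable
  have hM : conjVec (a 0) = a 0 := by
    have h := hacs 0
    rw [neg_zero] at h
    exact h.symm
  have hbr : RapidDecay (Function.update a 0 0) := rapidDecay_update har
  -- the drift direction as a real vector of `ℂ³`
  set M₁ : EuclideanSpace ℂ (Fin 3) := WithLp.toLp 2 (fun j : Fin 3 => ((dir j : ℤ) : ℂ)) with hM₁def
  have hM₁j : ∀ j : Fin 3, M₁ j = ((dir j : ℤ) : ℂ) := fun j => rfl
  have hM₁ : conjVec M₁ = M₁ := by
    ext j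
    rw [conjVec_apply, hM₁j, map_intCast]
  have hkM₁ : ∀ k : Fin 3 → ℤ, (∑ jj : Fin 3, ((k jj : ℤ) : ℂ) * M₁ jj) = ∑ i, ((k i : ℤ) : ℂ) * ((dir i : ℤ) : ℂ) :=
    fun k => Finset.sum_congr rfl fun j _ => by rw [hM₁j]
  -- the steady equation of `u₀` on the Fourier side
  have heq₀ : ∀ k : (Fin 3 → ℤ), (((ν * (4 * Real.pi ^ 2 * freqNormSq k)) : ℝ) : ℂ) • a k + Torus.lerayCoeff k
      ((WithLp.toLp 2 (fun pp : Fin 3 => transportSym (fun jj mm => a mm jj) (fun mm => a mm pp) k) : EuclideanSpace ℂ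
      (Fin 3))) = mFourierCoeff (complexify ∘ force S c) k := fun k => by
    rw [ha, fourier_eq_of_isSteadyNSState' hst (isSmooth_force' c) k, lerayCoeff_forceCoeff]
  -- §2 the state space, the bilinear map, the force map, the two drifts
  obtain ⟨W, hW, hWc⟩ := exists_space
  haveI : CompleteSpace W := completeSpace_W hWc
  obtain ⟨B, hB, hBb⟩ := exists_bilinear hW
  obtain ⟨Fm, hFm⟩ := exists_forceMap (S := S) hW
  obtain ⟨D₀, hD₀, hD₀c⟩ := exists_drift hW hWc hM
  obtain ⟨D₁, hD₁, hD₁c⟩ := exists_drift hW hWc hM₁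
  -- §3 the base point `x₀` (physical coefficients = the punctured family `a°`) and the kernel vector `g`
  set X₀ : (Fin 3 → ℤ) → (EuclideanSpace ℂ (Fin 3)) := fun k => ((freqNormSq k : ℝ) : ℂ) • a k with hX₀
  have hX₀r : RapidDecay X₀ := by
    refine har.of_norm_le_mul_pow (C := 1) (s := 1) fun k => ?_
    rw [hX₀]
    dsimp only
    rw [norm_smul, Complex.norm_real, Real.norm_of_nonneg (freqNormSq_nonneg k), one_mul, pow_one]
    exact mul_le_mul_of_nonneg_right (by linarith [freqNormSq_nonneg k]) (norm_nonneg _)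
  have hX00 : X₀ 0 = 0 := by simp [hX₀, freqNormSq_zero]
  have hX₀V : ((X₀ : (Fin 3 → ℤ) → EuclideanSpace ℂ (Fin 3)) 0 = 0 ∧ (∀ kk : Fin 3 → ℤ, (∑ jj : Fin 3, ((kk jj : ℤ) :
      ℂ) * ((X₀ : (Fin 3 → ℤ) → EuclideanSpace ℂ (Fin 3)) kk) jj) = 0) ∧ IsConjSymm (X₀ : (Fin 3 → ℤ) → EuclideanSpace
      ℂ (Fin 3))) := by
    refine ⟨hX00, fun k => by rw [hX₀]; dsimp only; rw [kdot_smul, hat k, mul_zero], fun k => ?_⟩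
    rw [hX₀]
    dsimp only
    rw [freqNormSq_neg, hacs k, conjVec_smul, Complex.conj_ofReal]
  set x₀ : W := ⟨⟨X₀, memℓp_two_of_rapidDecay hX₀r⟩, (hW _).2 hX₀V⟩ with hx₀def
  have hx₀ : ((x₀ : (lp (fun _ : Fin 3 → ℤ => EuclideanSpace ℂ (Fin 3)) 2)) : (Fin 3 → ℤ) → (EuclideanSpace ℂ (Fin
      3))) = X₀ := rfl
  have hcfX : ((fun mm : Fin 3 → ℤ => (((freqNormSq mm)⁻¹ : ℝ) : ℂ)) • (X₀ : (Fin 3 → ℤ) → EuclideanSpace ℂ (Fin 3)))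
      = Function.update a 0 0 := by rw [hX₀]; exact cf_weight_smul' a
  have hcf : ((fun mm : Fin 3 → ℤ => (((freqNormSq mm)⁻¹ : ℝ) : ℂ)) • (((x₀ : (lp (fun _ : Fin 3 → ℤ => EuclideanSpace
      ℂ (Fin 3)) 2)) : (Fin 3 → ℤ) → (EuclideanSpace ℂ (Fin 3))) : (Fin 3 → ℤ) → EuclideanSpace ℂ (Fin 3))) =
      Function.update a 0 0 := by rw [hx₀]; exact hcfX
  obtain ⟨g, hg⟩ := exists_stateVec hW hv₁ hv₂ hv₃
  -- §4 the drifted steady map `G`, the unfolding operator `A`, the linearisation `T`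
  set cν : ℝ := 4 * Real.pi ^ 2 * ν with hcν
  have hcν0 : cν ≠ 0 := by positivity
  set cα : ℝ := 4 * Real.pi ^ 2 * α with hcα
  set G : W → W := fun x => cν • x + D₀ x + B x x with hG
  set A : W →L[ℝ] W := D₁ - cα • ContinuousLinearMap.id ℝ W with hA
  set K : W →L[ℝ] W := (hBb.deriv (x₀, x₀)).comp ((ContinuousLinearMap.id ℝ W).prod (ContinuousLinearMap.id ℝ W))
    with hK
  have hKw : ∀ w, K w = B x₀ w + B w x₀ := fun w => by simp [hK, IsBoundedBilinearMap.deriv_apply]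
  have hGd : HasStrictFDerivAt G (cν • ContinuousLinearMap.id ℝ W + (D₀ + K)) x₀ := by
    have h := (hasStrictFDerivAt_steadyMap hBb cν x₀).add (D₀.hasStrictFDerivAt (x := x₀))
    have e : G = fun x => (cν • x + B x x) + D₀ x := by
      funext x
      simp only [hG]
      abel
    rw [e]
    refine h.congr_fderiv ?_
    rw [hK]
    abel
  have hKc : IsCompactOperator K := isCompactOperator_linearised hWc hB x₀ (by rw [hcf]; exact hbr) K hKw
  have hDKc : IsCompactOperator (D₀ + K) := hD₀c.add hKc
  have hGcd : ContDiffAt ℝ 1 G x₀ := by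
    have h1 : ContDiff ℝ 1 (fun x : W => cν • x) := contDiff_id.const_smul cν
    have h2 : ContDiff ℝ 1 (fun x : W => B x x) := (hBb.contDiff (n := 1)).comp (contDiff_id.prodMk contDiff_id)
    have h3 : ContDiff ℝ 1 (fun x : W => D₀ x) := D₀.contDiff
    exact ((h1.add h3).add h2).contDiffAt
  -- coordinates of `G`, `A`
  have hGcoe : ∀ x : W, (((G x : W) : (lp (fun _ : Fin 3 → ℤ => EuclideanSpace ℂ (Fin 3)) 2)) : (Fin 3 → ℤ) →
      (EuclideanSpace ℂ (Fin 3))) = fun k => ((cν : ℝ) : ℂ) • ((x : (lp (fun _ : Fin 3 → ℤ => EuclideanSpace ℂ (Fin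
      3)) 2)) : (Fin 3 → ℤ) → (EuclideanSpace ℂ (Fin 3))) k +
      (2 * Real.pi * Complex.I * (∑ jj : Fin 3, ((k jj : ℤ) : ℂ) * (a 0) jj)) • (((fun mm : Fin 3 → ℤ => (((freqNormSq
          mm)⁻¹ : ℝ) : ℂ)) • (((x : (lp (fun _ : Fin 3 → ℤ => EuclideanSpace ℂ (Fin 3)) 2)) : (Fin 3 → ℤ) →
          (EuclideanSpace ℂ (Fin 3))) : (Fin 3 → ℤ) → EuclideanSpace ℂ (Fin 3)))) k +
      Torus.lerayCoeff k ((WithLp.toLp 2 (fun pp : Fin 3 => transportSym (fun jj mm => (((fun mm : Fin 3 →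
          ℤ => (((freqNormSq mm)⁻¹ : ℝ) : ℂ)) • (((x : (lp (fun _ : Fin 3 → ℤ => EuclideanSpace ℂ (Fin 3)) 2)) : (Fin
          3 → ℤ) → (EuclideanSpace ℂ (Fin 3))) : (Fin 3 → ℤ) → EuclideanSpace ℂ (Fin 3)))) mm jj) (fun mm => (((fun
          mm : Fin 3 → ℤ => (((freqNormSq mm)⁻¹ : ℝ) : ℂ)) • (((x : (lp (fun _ : Fin 3 → ℤ => EuclideanSpace ℂ (Fin
          3)) 2)) : (Fin 3 → ℤ) → (EuclideanSpace ℂ (Fin 3))) : (Fin 3 → ℤ) → EuclideanSpace ℂ (Fin 3)))) mm pp) k) :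
          EuclideanSpace ℂ (Fin 3))) := by
    intro x
    rw [hG]
    dsimp only
    rw [coeW_add, coeW_add, coeW_smul, hB, hD₀]
    funext k
    simp only [Pi.add_apply, Pi.smul_apply, Complex.coe_smul]
  have hAcoe : ∀ (x : W) (k : Fin 3 → ℤ), (((A x : W) : (lp (fun _ : Fin 3 → ℤ => EuclideanSpace ℂ (Fin 3)) 2)) :
      (Fin 3 → ℤ) → (EuclideanSpace ℂ (Fin 3))) k =
      (2 * Real.pi * Complex.I * (∑ jj : Fin 3, ((k jj : ℤ) : ℂ) * M₁ jj)) • (((fun mm : Fin 3 → ℤ => (((freqNormSq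
          mm)⁻¹ : ℝ) : ℂ)) • (((x : (lp (fun _ : Fin 3 → ℤ => EuclideanSpace ℂ (Fin 3)) 2)) : (Fin 3 → ℤ) →
          (EuclideanSpace ℂ (Fin 3))) : (Fin 3 → ℤ) → EuclideanSpace ℂ (Fin 3)))) k -
        ((cα : ℝ) : ℂ) • ((x : (lp (fun _ : Fin 3 → ℤ => EuclideanSpace ℂ (Fin 3)) 2)) : (Fin 3 → ℤ) →
          (EuclideanSpace ℂ (Fin 3))) k := by
    intro x k
    have e : A x = D₁ x - cα • x := by simp [hA]
    rw [e, coeW_sub, coeW_smul, hD₁, Pi.sub_apply, Pi.smul_apply, Complex.coe_smul]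
  -- the linearisation and its coordinates in the full-family form
  set T : W →L[ℝ] W := cν • ContinuousLinearMap.id ℝ W + (D₀ + K) with hT
  have hTw : ∀ w : W, T w = cν • w + (D₀ w + K w) := fun w => by simp [hT]
  have hTcoe : ∀ (w : W) (k : (Fin 3 → ℤ)), (((T w : W) : (lp (fun _ : Fin 3 → ℤ => EuclideanSpace ℂ (Fin 3)) 2)) :
      (Fin 3 → ℤ) → (EuclideanSpace ℂ (Fin 3))) k =
      (((4 * Real.pi ^ 2 * ν : ℝ)) : ℂ) • ((w : (lp (fun _ : Fin 3 → ℤ => EuclideanSpace ℂ (Fin 3)) 2)) : (Fin 3 → ℤ)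
          → (EuclideanSpace ℂ (Fin 3))) k +
        Torus.lerayCoeff k ((WithLp.toLp 2 (fun pp : Fin 3 => transportSym (fun jj mm => a mm jj) (fun mm => (((fun
            mm : Fin 3 → ℤ => (((freqNormSq mm)⁻¹ : ℝ) : ℂ)) • (((w : (lp (fun _ : Fin 3 → ℤ => EuclideanSpace ℂ (Fin
            3)) 2)) : (Fin 3 → ℤ) → (EuclideanSpace ℂ (Fin 3))) : (Fin 3 → ℤ) → EuclideanSpace ℂ (Fin 3)))) mm pp)
            k) : EuclideanSpace ℂ (Fin 3)) + (WithLp.toLp 2 (fun pp : Fin 3 => transportSym (fun jj mm => (((fun mm :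
            Fin 3 → ℤ => (((freqNormSq mm)⁻¹ : ℝ) : ℂ)) • (((w : (lp (fun _ : Fin 3 → ℤ => EuclideanSpace ℂ (Fin 3))
            2)) : (Fin 3 → ℤ) → (EuclideanSpace ℂ (Fin 3))) : (Fin 3 → ℤ) → EuclideanSpace ℂ (Fin 3)))) mm jj) (fun
            mm => a mm pp) k) : EuclideanSpace ℂ (Fin 3))) := by
    intro w k
    have h : (((T w : W) : (lp (fun _ : Fin 3 → ℤ => EuclideanSpace ℂ (Fin 3)) 2)) : (Fin 3 → ℤ) →
        (EuclideanSpace ℂ (Fin 3))) k = ((cν : ℝ) : ℂ) • ((w : (lp (fun _ : Fin 3 → ℤ => EuclideanSpace ℂ (Fin 3))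
        2)) : (Fin 3 → ℤ) → (EuclideanSpace ℂ (Fin 3))) k +
        ((2 * Real.pi * Complex.I * (∑ jj : Fin 3, ((k jj : ℤ) : ℂ) * (a 0) jj)) • (((fun mm : Fin 3 →
            ℤ => (((freqNormSq mm)⁻¹ : ℝ) : ℂ)) • (((w : (lp (fun _ : Fin 3 → ℤ => EuclideanSpace ℂ (Fin 3)) 2)) :
            (Fin 3 → ℤ) → (EuclideanSpace ℂ (Fin 3))) : (Fin 3 → ℤ) → EuclideanSpace ℂ (Fin 3)))) k +
          (Torus.lerayCoeff k ((WithLp.toLp 2 (fun pp : Fin 3 => transportSym (fun jj mm => (Function.update a 0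
              0) mm jj) (fun mm => (((fun mm : Fin 3 → ℤ => (((freqNormSq mm)⁻¹ : ℝ) : ℂ)) • (((w : (lp (fun _ :
              Fin 3 → ℤ => EuclideanSpace ℂ (Fin 3)) 2)) : (Fin 3 → ℤ) → (EuclideanSpace ℂ (Fin 3))) : (Fin 3 → ℤ)
              → EuclideanSpace ℂ (Fin 3)))) mm pp) k) : EuclideanSpace ℂ (Fin 3))) +
            Torus.lerayCoeff k ((WithLp.toLp 2 (fun pp : Fin 3 => transportSym (fun jj mm => (((fun mm : Fin 3 →
                ℤ => (((freqNormSq mm)⁻¹ : ℝ) : ℂ)) • (((w : (lp (fun _ : Fin 3 → ℤ => EuclideanSpace ℂ (Fin 3))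
                2)) : (Fin 3 → ℤ) → (EuclideanSpace ℂ (Fin 3))) : (Fin 3 → ℤ) → EuclideanSpace ℂ (Fin 3)))) mm jj)
                (fun mm => (Function.update a 0 0) mm pp) k) : EuclideanSpace ℂ (Fin 3))))) := by
      rw [hTw, coeW_add, Pi.add_apply, coeW_add, hKw, coeW_add, coeW_smul, hB, hB, hD₀, hcf]
      simp only [Pi.add_apply, Pi.smul_apply, Complex.coe_smul]
    rw [h, ← hcν, leray_nl_linearised_update har (w : (lp (fun _ : Fin 3 → ℤ => EuclideanSpace ℂ (Fin 3)) 2))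
      (W_trans hW w) k]
    abel
  -- §5 lattice solutions of `T x = −Π ĝ` are classical solutions of `L(ν,u₀) w = g`
  have hsolveT : ∀ (x : W) (gf : (UnitAddTorus (Fin 3)) → (EuclideanSpace ℂ (Fin 3))), IsSmooth gf →
      mFourierCoeff gf 0 = 0 →
      (∀ k : (Fin 3 → ℤ), (((T x : W) : (lp (fun _ : Fin 3 → ℤ => EuclideanSpace ℂ (Fin 3)) 2)) : (Fin 3 → ℤ) →
        (EuclideanSpace ℂ (Fin 3))) k = -Torus.lerayCoeff k (mFourierCoeff gf k)) →
      ∃ w, Torus.LinNSResolventRel ν u₀ 0 w gf ∧ mFourierCoeff w = ((fun mm : Fin 3 → ℤ => (((freqNormSq mm)⁻¹ :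
        ℝ) : ℂ)) • (((x : (lp (fun _ : Fin 3 → ℤ => EuclideanSpace ℂ (Fin 3)) 2)) : (Fin 3 → ℤ) → (EuclideanSpace ℂ
        (Fin 3))) : (Fin 3 → ℤ) → EuclideanSpace ℂ (Fin 3))) := by
    intro x gf hgs hg0 hco
    exact exists_linNSResolventRel_of_latticeEq hν hu₀ hdiv₀ hgs hg0
      (x : (lp (fun _ : Fin 3 → ℤ => EuclideanSpace ℂ (Fin 3)) 2)) (W_zero hW x) (W_trans hW x)
      (fun k => by rw [← hTcoe]; exact hco k)
  have hcplx : ∀ u : (UnitAddTorus (Fin 3)) → (EuclideanSpace ℝ (Fin 3)), cplx u = complexify ∘ u := fun u => by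
    funext y; simp only [cplx, Function.comp_apply, realToComplex_eq_complexify]
  -- kernel transfer: `T x = 0 ⇒ x ∈ ℝ·g`
  have hVcs : IsConjSymm (mFourierCoeff (complexify ∘ v)) := isConjSymm_mFourierCoeff hv₁.integrable
  have hkerT : ∀ x : W, T x = 0 → ∃ z : ℝ, x = z • g := by
    intro x hx
    have hz : ∀ k, mFourierCoeff (0 : (UnitAddTorus (Fin 3)) → (EuclideanSpace ℂ (Fin 3))) k = 0 := fun k => by
      rw [show (0 : (UnitAddTorus (Fin 3)) → (EuclideanSpace ℂ (Fin 3))) = (0 : ℂ) • (0 : (UnitAddTorus (Fin 3)) →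
          (EuclideanSpace ℂ (Fin 3))) by simp, mFourierCoeff_const_smul, zero_smul]
    obtain ⟨w, hrel, hŵ⟩ := hsolveT x 0 (isSmooth_const (0 : (EuclideanSpace ℂ (Fin 3)))) (hz 0) (fun k => by
      rw [hx, Submodule.coe_zero, hz, lerayCoeff_zero_vec, neg_zero]; rfl)
    obtain ⟨z, hwz⟩ := hker w hrel
    have hcfx : ∀ k, (((fun mm : Fin 3 → ℤ => (((freqNormSq mm)⁻¹ : ℝ) : ℂ)) • (((x : (lp (fun _ : Fin 3 →
        ℤ => EuclideanSpace ℂ (Fin 3)) 2)) : (Fin 3 → ℤ) → (EuclideanSpace ℂ (Fin 3))) : (Fin 3 → ℤ) → EuclideanSpace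
        ℂ (Fin 3)))) k = z • mFourierCoeff (complexify ∘ v) k := by
      intro k
      rw [← hŵ, hwz, hcplx, mFourierCoeff_const_smul]
    have hre := eq_re_smul_of_isConjSymm (isConjSymm_cf (W_conj hW x)) hVcs hcfx
    refine ⟨z.re, Subtype.ext (lp.ext ?_)⟩
    refine eq_of_cf_eq (W_zero hW x) (W_zero hW (z.re • g)) ?_
    rw [coeW_smul, cf_real_smul, hg]
    funext k
    rw [hre k, Pi.smul_apply]
  -- §6 the border: `A x₀` is the coefficient family of `h = αΔu₀ + dir·∇u₀`, which is outside the range of `T`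
  set bf : (UnitAddTorus (Fin 3)) → (EuclideanSpace ℝ (Fin 3)) := fun y => α • laplacian u₀ y + ∑ i, (dir i : ℝ) •
      Torus.partialDeriv i u₀ y with hbfdef
  have hbfs : IsSmooth bf := isSmooth_border hu₀ α dir
  have hĥ : ∀ k : Fin 3 → ℤ, mFourierCoeff (complexify ∘ bf) k = (-(((α * (4 * Real.pi ^ 2 * freqNormSq k) : ℝ)) : ℂ)
      + 2 * Real.pi * Complex.I * (∑ i, ((k i : ℤ) : ℂ) * ((dir i : ℤ) : ℂ))) • a k := fun k => by
    rw [hbfdef, ha]; exact mFourierCoeff_border hu₀ α dir k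
  have hĥ0 : mFourierCoeff (complexify ∘ bf) 0 = 0 := by
    rw [hĥ]; simp [freqNormSq_zero]
  have hĥt : ∀ k : Fin 3 → ℤ, (∑ jj : Fin 3, ((k jj : ℤ) : ℂ) * (mFourierCoeff (complexify ∘ bf) k) jj) = 0 := fun k => by
    rw [hĥ, kdot_smul, hat k, mul_zero]
  have hfix : ∀ k : Fin 3 → ℤ, Torus.lerayCoeff k (mFourierCoeff (complexify ∘ bf) k) = mFourierCoeff (complexify ∘ bf) k :=
    fun k => by
    by_cases hk : k = 0
    · rw [hk, hĥ0, lerayCoeff_zero_vec]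
    · exact lerayCoeff_of_kdot_eq_zero hk (hĥt k)
  have hAx₀ : ∀ k : Fin 3 → ℤ, (((A x₀ : W) : (lp (fun _ : Fin 3 → ℤ => EuclideanSpace ℂ (Fin 3)) 2)) : (Fin 3 → ℤ) →
      (EuclideanSpace ℂ (Fin 3))) k = mFourierCoeff (complexify ∘ bf) k := by
    intro k
    rw [hAcoe, hcf, hx₀, hĥ, hkM₁]
    by_cases hk : k = 0
    · subst hk
      simp [hX₀, freqNormSq_zero]
    · rw [Function.update_of_ne hk, hX₀]
      dsimp only
      rw [smul_smul, ← sub_smul, hcα]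
      congr 1
      push_cast
      ring
  have hrangeA : ∀ x : W, T x ≠ A x₀ := by
    intro x hx
    have hx' : T (-x) = -(A x₀) := by rw [map_neg, hx]
    obtain ⟨w, hrel, -⟩ := hsolveT (-x) (complexify ∘ bf) hbfs.complexify_comp hĥ0 (fun k => by
      rw [hx', Submodule.coe_neg, lp.coeFn_neg, Pi.neg_apply, hAx₀, hfix])
    exact hvis w (by rw [hcplx]; exact hrel)
  -- §7 the isomorphism `J = cν·1`; `T − J = D₀ + K` is compact; the base equation
  set J : W ≃L[ℝ] W := ContinuousLinearEquiv.equivOfInverse (cν • ContinuousLinearMap.id ℝ W)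
    (cν⁻¹ • ContinuousLinearMap.id ℝ W)
    (fun x => by
      change cν⁻¹ • (cν • x) = x
      rw [smul_smul, inv_mul_cancel₀ hcν0, one_smul])
    (fun x => by
      change cν • (cν⁻¹ • x) = x
      rw [smul_smul, mul_inv_cancel₀ hcν0, one_smul]) with hJ
  have hTJ : (T - (J : W →L[ℝ] W) : W →L[ℝ] W) = D₀ + K := by
    ext w
    simp [hT, hJ]
  have hKTJ : IsCompactOperator (T - (J : W →L[ℝ] W) : W →L[ℝ] W) := by rw [hTJ]; exact hDKc
  have hGx₀ : G x₀ = Fm c := by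
    refine Subtype.ext (lp.ext (funext fun k => ?_))
    rw [hGcoe, hFm]
    dsimp only
    rw [hx₀, smul_eq_weight_smul_cf hX00 k, hcfX, ← heq₀ k, leray_nl_self_update har hat k, weight_smul_update]
    abel
  set FmL : Coeff S →L[ℝ] W := LinearMap.toContinuousLinearMap Fm with hFmL
  have hFmL : ∀ d, FmL d = Fm d := fun d => rfl
  have hGx₀' : G x₀ = FmL c := by rw [hFmL]; exact hGx₀
  -- §8 radii, and the abstract bordered persistence along the intrinsic unfolding
  set C : ℝ := 1 + 4 * Real.pi ^ 2 + ‖M₁‖ ^ 2 with hC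
  have hC1 : (1 : ℝ) ≤ C := by nlinarith [sq_nonneg ‖M₁‖, sq_nonneg Real.pi]
  have hC0 : 0 < C := lt_of_lt_of_le one_pos hC1
  have hα1 : 0 < |α| + 1 := by positivity
  set δ' : ℝ := min 1 (min (ν / (2 * (|α| + 1))) (δ / (2 * C * (|α| + 1)))) with hδ'
  have hδ'0 : 0 < δ' := lt_min one_pos (lt_min (by positivity) (by positivity))
  have hδ'1 : δ' ≤ 1 := min_le_left _ _
  have hδ'ν : δ' ≤ ν / (2 * (|α| + 1)) := (min_le_right _ _).trans (min_le_left _ _)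
  have hδ'δ : δ' ≤ δ / (2 * C * (|α| + 1)) := (min_le_right _ _).trans (min_le_right _ _)
  have hLν := (le_div_iff₀ (by positivity)).1 hδ'ν
  have hLδ := (le_div_iff₀ (by positivity)).1 hδ'δ
  obtain ⟨ρ, hρ, hsol⟩ := bordered_unfolding_persistence G A FmL T J x₀ g c hGcd hGd.hasFDerivAt hGx₀' hKTJ hkerT
    hrangeA δ' hδ'0
  refine ⟨ρ, hρ, fun c' hc' => ?_⟩
  obtain ⟨x, t, hxd, htd, hGx⟩ := hsol c' hc'
  -- §9 the perturbed lattice solution is a classical steady state at viscosity `ν − tα` with mean `a(0) + t·dir`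
  set ν' : ℝ := ν - t * α with hν'
  have htα : |t * α| < δ' * (|α| + 1) := by
    rw [abs_mul]
    nlinarith [abs_nonneg t, abs_nonneg α, mul_lt_mul_of_pos_right htd hα1]
  have hν'pos : 0 < ν' := by
    have h := le_abs_self (t * α)
    rw [hν']
    linarith
  have hν'close : |ν' - ν| < δ := by
    have e : ν' - ν = -(t * α) := by rw [hν']; ring
    have h2 : δ' * (|α| + 1) * 2 ≤ δ' * (2 * C * (|α| + 1)) := by nlinarith [mul_nonneg hδ'0.le hα1.le]
    rw [e, abs_neg]
    linarith
  set M' : EuclideanSpace ℂ (Fin 3) := a 0 + (t : ℂ) • M₁ with hM'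
  have hkM' : ∀ k : Fin 3 → ℤ, (∑ jj : Fin 3, ((k jj : ℤ) : ℂ) * M' jj) = (∑ jj : Fin 3, ((k jj : ℤ) : ℂ) * (a 0) jj)
      + (t : ℂ) * (∑ jj : Fin 3, ((k jj : ℤ) : ℂ) * M₁ jj) := fun k => by
    rw [hM', kdot_add, kdot_smul]
  have hM'c : conjVec M' = M' := by
    rw [hM', conjVec_add, conjVec_smul, Complex.conj_ofReal, hM, hM₁]
  -- the perturbed equation, coordinatewise, in the drifted form at viscosity `ν'` with zero mode `M'`
  have hxeq : ∀ k : (Fin 3 → ℤ), (((4 * Real.pi ^ 2 * ν' : ℝ)) : ℂ) • ((x : (lp (fun _ : Fin 3 → ℤ => EuclideanSpace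
      ℂ (Fin 3)) 2)) : (Fin 3 → ℤ) → (EuclideanSpace ℂ (Fin 3))) k +
      (2 * Real.pi * Complex.I * (∑ jj : Fin 3, ((k jj : ℤ) : ℂ) * M' jj)) • (((fun mm : Fin 3 → ℤ => (((freqNormSq
          mm)⁻¹ : ℝ) : ℂ)) • (((x : (lp (fun _ : Fin 3 → ℤ => EuclideanSpace ℂ (Fin 3)) 2)) : (Fin 3 → ℤ) →
          (EuclideanSpace ℂ (Fin 3))) : (Fin 3 → ℤ) → EuclideanSpace ℂ (Fin 3)))) k +
      Torus.lerayCoeff k ((WithLp.toLp 2 (fun pp : Fin 3 => transportSym (fun jj mm => (((fun mm : Fin 3 →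
          ℤ => (((freqNormSq mm)⁻¹ : ℝ) : ℂ)) • (((x : (lp (fun _ : Fin 3 → ℤ => EuclideanSpace ℂ (Fin 3)) 2)) : (Fin
          3 → ℤ) → (EuclideanSpace ℂ (Fin 3))) : (Fin 3 → ℤ) → EuclideanSpace ℂ (Fin 3)))) mm jj) (fun mm => (((fun
          mm : Fin 3 → ℤ => (((freqNormSq mm)⁻¹ : ℝ) : ℂ)) • (((x : (lp (fun _ : Fin 3 → ℤ => EuclideanSpace ℂ (Fin
          3)) 2)) : (Fin 3 → ℤ) → (EuclideanSpace ℂ (Fin 3))) : (Fin 3 → ℤ) → EuclideanSpace ℂ (Fin 3)))) mm pp) k) :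
          EuclideanSpace ℂ (Fin 3))) =
      mFourierCoeff (complexify ∘ force S c') k := by
    intro k
    have h1 : (((G x + t • A x : W) : (lp (fun _ : Fin 3 → ℤ => EuclideanSpace ℂ (Fin 3)) 2)) : (Fin 3 → ℤ) →
        (EuclideanSpace ℂ (Fin 3))) k = (((FmL c' : W) : (lp (fun _ : Fin 3 → ℤ => EuclideanSpace ℂ (Fin 3)) 2)) :
        (Fin 3 → ℤ) → (EuclideanSpace ℂ (Fin 3))) k := by rw [hGx]
    have e1 : (((G x + t • A x : W) : (lp (fun _ : Fin 3 → ℤ => EuclideanSpace ℂ (Fin 3)) 2)) : (Fin 3 → ℤ) →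
        (EuclideanSpace ℂ (Fin 3))) k = (((G x : W) : (lp (fun _ : Fin 3 → ℤ => EuclideanSpace ℂ (Fin 3)) 2)) : (Fin 3
        → ℤ) → (EuclideanSpace ℂ (Fin 3))) k + (t : ℂ) • (((A x : W) : (lp (fun _ : Fin 3 → ℤ => EuclideanSpace ℂ (Fin
        3)) 2)) : (Fin 3 → ℤ) → (EuclideanSpace ℂ (Fin 3))) k := by
      rw [coeW_add, coeW_smul, Pi.add_apply, Pi.smul_apply, Complex.coe_smul]
    rw [e1, hGcoe, hAcoe, hFmL, hFm] at h1
    beta_reduce at h1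
    rw [← h1, hkM', hν', hcν, hcα]
    push_cast
    module
  obtain ⟨u', p', hst', hu', hû'⟩ := exists_steadyState_of_drifted_eq hW hν'pos c' x hM'c hxeq
  refine ⟨ν', u', p', hν'close, hst', ?_⟩
  -- §10 the `H¹` estimate: `𝓕u₀ = x̌₀ + δ₀ a(0)`, `𝓕u' = x̌ + δ₀ M'`, `M' − a(0) = t M₁`
  have ha' : mFourierCoeff (complexify ∘ u₀) = ((fun mm : Fin 3 → ℤ => (((freqNormSq mm)⁻¹ : ℝ) : ℂ)) • (((x₀ : (lp
      (fun _ : Fin 3 → ℤ => EuclideanSpace ℂ (Fin 3)) 2)) : (Fin 3 → ℤ) → (EuclideanSpace ℂ (Fin 3))) : (Fin 3 → ℤ) →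
      EuclideanSpace ℂ (Fin 3))) + (Pi.single (0 : (Fin 3 → ℤ)) (a 0) : (Fin 3 → ℤ) → (EuclideanSpace ℂ (Fin 3))) := by
    rw [hcf, ← ha]
    exact (update_add_single a).symm
  have hH := h1DistSq_le_of_states hu' hu₀ x x₀ M' (a 0) hû' ha'
  have hMd : M' - a 0 = (t : ℂ) • M₁ := by rw [hM']; abel
  rw [hMd] at hH
  have hzn : ‖x - x₀‖ < δ' := by rwa [← dist_eq_norm]
  have hz2 : ‖x - x₀‖ ^ 2 ≤ δ' * δ' := by
    have := norm_nonneg (x - x₀)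
    nlinarith
  have ht2 : t ^ 2 ≤ δ' * δ' := by
    have h := abs_nonneg t
    have h' : |t| ^ 2 ≤ δ' * δ' := by nlinarith
    rwa [sq_abs] at h'
  have hd : δ' * δ' ≤ δ' := by nlinarith
  have hCδ : C * δ' ≤ δ / 2 := by
    have h2 : C * δ' * 2 ≤ δ' * (2 * C * (|α| + 1)) := by nlinarith [mul_nonneg hC0.le hδ'0.le, abs_nonneg α]
    linarith
  calc h1DistSq u' u₀
      ≤ (1 + 4 * Real.pi ^ 2) * ‖x - x₀‖ ^ 2 + ‖(t : ℂ) • M₁‖ ^ 2 := hH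
    _ = (1 + 4 * Real.pi ^ 2) * ‖x - x₀‖ ^ 2 + t ^ 2 * ‖M₁‖ ^ 2 := by
        rw [norm_smul, Complex.norm_real, Real.norm_eq_abs, mul_pow, sq_abs]
    _ ≤ (1 + 4 * Real.pi ^ 2) * (δ' * δ') + (δ' * δ') * ‖M₁‖ ^ 2 :=
        add_le_add (mul_le_mul_of_nonneg_left hz2 (by positivity)) (mul_le_mul_of_nonneg_right ht2 (sq_nonneg _))
    _ = C * (δ' * δ') := by rw [hC]; ring
    _ ≤ C * δ' := mul_le_mul_of_nonneg_left hd hC0.le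
    _ ≤ δ / 2 := hCδ
    _ < δ := half_lt_self hδ

end Main

end Summit.AnomalousDissipation.AnomalousDissipation.Theorems.RobustLoudUpgrade.Unfolding

end
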